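import Literature.Barriers.CriticalPhenomena.RigorousRGSmallParameterRGMapDefinition
import Literature.Barriers.CriticalPhenomena.RigorousRGSmallParameterSmallSetNeighbourhood
import Literature.Barriers.CriticalPhenomena.RigorousRGSmallParameterStabilityIupper
import HarnessLib

/-!
# `RigorousRGSmallParameter` (Slade, Theorem 1.4.1): regularity of Slade's RG step data —
# `I_j(V,B) ∈ 𝒩(B^□)` smooth, `J(X,B) ∈ 𝒩(B^□)`, and `StepRegular` for `sladeStepData`

Companion ("proof architecture") file of
`Literature/Barriers/CriticalPhenomena/RigorousRGSmallParameter.lean`. The representation identity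
of Slade's RG map (`…RGMapDefinition.expectF_theta_circ_eq_kPlusSlade`, §6.3) was proved under
`StepRegular` — field locality `I(B), Î(B) ∈ 𝒩(B^□)`, `J(U,B) ∈ 𝒩(B^□)` ([BS-rg-step] (4.3)),
measurability, support of `J` on `𝒟(J)`, and `K ∈ 𝒦_j` (Slade Definition 6.1.2: field locality
`K(X) ∈ 𝒩(X^□)` and component factorisation). This file DISCHARGES `StepRegular` for the concrete
data `sladeStepData` from admissible parameters (`StepParams.Adm`: `0 < L^j ∣ L^N`, `[φ]_j > 0`,
no wrapping `2(⌊d_+⌋+1) < L^N`, range of `w_j` and reach `⌊d_+⌋` at most `L^j`, `A ≥ 4`) and the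
`𝒦_j`-properties of `K`:

* `dependsOn_localPolySum` (smoothness `LocalPoly.contDiff_localPolySum` is imported from `…StabilityIupper`), `contDiff_WB`, **`contDiff_Ifun`**,
  `measurable_Ifun`;
* **`dependsOn_Wfun`** (`W_j(V,x) ∈ 𝒩(reach(x,R))`, `R ≥` range of `w_j` and `≥ ⌊d_+⌋`: the
  `F_{w_j}` term by `dependsOn_FC_localPoly_localPolySum`, the `Loc_x` term by `dependsOn_locX`),
  **`dependsOn_Ifun_block`** (`I_j(V,B) ∈ 𝒩(B^□)`, via `reach_subset_sclosure_block`),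
  `dependsOn_mapOneJ_block`;
* `StepParams.Adm`, **`stepRegular_sladeStepData`**.

With this, the only hypotheses left in the representation identity for Slade's concrete map are
the positivity/range conditions on `C_{j+1}` and `L`, `K ∈ 𝒦_j`, and the integrability of the Map-3
terms in the fluctuation field (an analytic input: [BS-rg-IE] integrability of the regulators).

Sources: G. Slade, arXiv:1611.06169, §4.3 ((4.11)–(4.12)), §6.1 (`I_j(V,B)`), Definition 6.1.2;
D. C. Brydges, G. Slade, arXiv:1403.7256, §4.1 ((4.1)–(4.3)).

## References

* [BrydgesSlade2015RGV] D. C. Brydges, G. Slade, *A renormalisation group method. V. A single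
  renormalisation group step*, J. Stat. Phys. **159** (2015) 589–667, arXiv:1403.7256.
* [Slade2017] G. Slade, *Critical exponents for long-range O(n) models below the upper critical
  dimension*, Commun. Math. Phys. **358** (2018) 343–436, arXiv:1611.06169.
-/

noncomputable section

namespace Literature.Barriers.CriticalPhenomena

namespace LongRangePhi4

namespace Polymer

open _root_.MeasureTheory Finset Literature.Probability.LatticeModels PTFun LocalPoly Loc
open scoped ContDiff

variable {d M n : ℕ} [NeZero M]

/-! ## Regularity (smoothness, measurability, field locality) of Slade's step data -/

section Regularity

omit [NeZero M] in
/-- `V(X) ∈ 𝒩(X)`. [folklore] -/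
theorem dependsOn_localPolySum (g ν u : ℝ) (X : Finset (TorusSite d M)) : DependsOn X (localPolySum (n := n) g ν u X) := by
  unfold localPolySum
  exact DependsOn.sum fun x hx => (dependsOn_localPoly g ν u x).mono (Finset.singleton_subset_iff.2 hx)

/-- `W_j(V,B)` is smooth. [folklore] -/
theorem contDiff_WB (pN : ℕ) (dφ dplus : ℝ) (w : TorusSite d M → TorusSite d M → ℝ) (A : ℕ) (g ν u : ℝ)
    (B : Finset (TorusSite d M)) : ContDiff ℝ ∞ (WB (n := n) pN dφ dplus w A g ν u B) := by
  unfold WB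
  exact ContDiff.sum fun x _ => contDiff_Wfun pN dφ dplus w A g ν u x

/-- **`I_j(V,X)` is smooth.** [folklore] -/
theorem contDiff_Ifun (b pN : ℕ) (dφ dplus : ℝ) (w : TorusSite d M → TorusSite d M → ℝ) (A : ℕ) (g ν u : ℝ)
    (X : Finset (TorusSite d M)) : ContDiff ℝ ∞ (Ifun (n := n) b pN dφ dplus w A g ν u X) := by
  unfold Ifun
  refine ContDiff.mul (Real.contDiff_exp.comp (contDiff_localPolySum g ν u X).neg) ?_
  exact contDiff_prod fun B _ => contDiff_const.add (contDiff_WB pN dφ dplus w A g ν u B)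

/-- `I_j(V,X)` is measurable. [folklore] -/
theorem measurable_Ifun (b pN : ℕ) (dφ dplus : ℝ) (w : TorusSite d M → TorusSite d M → ℝ) (A : ℕ) (g ν u : ℝ)
    (X : Finset (TorusSite d M)) : Measurable (Ifun (n := n) b pN dφ dplus w A g ν u X) :=
  (contDiff_Ifun b pN dφ dplus w A g ν u X).continuous.measurable

/-- **`W_j(V,x) ∈ 𝒩(reach(x, R))`** for `R ≥` the range of `w_j` and `≥ ⌊d_+⌋` (the term
`F_{w_j}(V_x, V(Λ))` has the range of `w_j`, `dependsOn_FC_localPoly_localPolySum`; the term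
`Loc_x(⋯)` has the reach of the local monomials, `dependsOn_locX`). [cite: Slade2017, §4.3 (display (4.11))] -/
theorem dependsOn_Wfun {pN : ℕ} {dφ dplus : ℝ} (hφ : 0 < dφ) (hK : 2 * ((⌊dplus⌋₊ : ℤ) + 1) < M)
    {w : TorusSite d M → TorusSite d M → ℝ} {r : ℕ} (hw : FinRange w r) {A : ℕ} (hA : 4 ≤ A) (g ν u : ℝ)
    (x : TorusSite d M) {R : ℕ} (hrR : r ≤ R) (hKR : ⌊dplus⌋₊ ≤ R) :
    DependsOn (reach x R) (Wfun (n := n) pN dφ dplus w A g ν u x) := by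
  have h1 : DependsOn (reach x R) (FC w A (localPoly (n := n) g ν u x) (localPolySum g ν u univ)) :=
    (dependsOn_FC_localPoly_localPolySum hw hA g ν u g ν u x).mono (reach_mono x hrR)
  have h2 : DependsOn (reach x R) (locPt pN dφ dplus x (FC w A (localPoly (n := n) g ν u x) (localPolySum g ν u univ))) := by
    unfold locPt
    refine dependsOn_locX hφ hK (fun y hy => ?_) x _
    rw [Finset.mem_singleton.1 hy]
    exact reach_mono x hKR
  intro φ ψ hφψ
  simp only [Wfun]
  rw [h1 φ ψ hφψ, h2 φ ψ hφψ]

/-- **`I_j(V,B) ∈ 𝒩(B^□)`** on `j`-blocks `B` (`b = L^j ∣ L^N`), provided the range of `w_j` and the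
reach `⌊d_+⌋` are at most `b`. [cite: Slade2017, Definition 6.1.2 (field locality) and §6.1 (I_j(V,B))] -/
theorem dependsOn_Ifun_block {b pN : ℕ} {dφ dplus : ℝ} (hb : 0 < b) (hbM : b ∣ M) (hφ : 0 < dφ)
    (hK : 2 * ((⌊dplus⌋₊ : ℤ) + 1) < M) {w : TorusSite d M → TorusSite d M → ℝ} {r : ℕ} (hw : FinRange w r)
    {A : ℕ} (hA : 4 ≤ A) (hrb : r ≤ b) (hKb : ⌊dplus⌋₊ ≤ b) (g ν u : ℝ) (x : TorusSite d M) :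
    DependsOn (sclosure b (block b x)) (Ifun (n := n) b pN dφ dplus w A g ν u (block b x)) := by
  have hV : DependsOn (sclosure b (block b x)) (localPolySum (n := n) g ν u (block b x)) :=
    (dependsOn_localPolySum g ν u _).mono (subset_sclosure b _)
  have hW : ∀ B ∈ blocksOf b (block b x), DependsOn (sclosure b (block b x)) (WB (n := n) pN dφ dplus w A g ν u B) := by
    intro B hB
    obtain ⟨y, hy, rfl⟩ := exists_eq_block_of_mem_blocksOf hB
    rw [block_eq_of_mem hy]
    unfold WB
    refine DependsOn.sum fun z hz => ?_
    exact (dependsOn_Wfun hφ hK hw hA g ν u z (le_max_left r ⌊dplus⌋₊) (le_max_right _ _)).mono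
      (reach_subset_sclosure_block hb hbM (max_le hrb hKb) hz)
  intro φ ψ hφψ
  simp only [Ifun]
  rw [hV φ ψ hφψ]
  congr 1
  exact Finset.prod_congr rfl fun B hB => by rw [hW B hB φ ψ hφψ]

/-- `J(X,B) ∈ 𝒩(B^□)` for Slade's Map-1 transfer on `j`-blocks `B`. [cite: BrydgesSlade2015RGV, §4.1 ((4.3))] -/
theorem dependsOn_mapOneJ_block {b pN : ℕ} {dφ dplus : ℝ} (hb : 0 < b) (hbM : b ∣ M) (hφ : 0 < dφ)
    (hK : 2 * ((⌊dplus⌋₊ : ℤ) + 1) < M) (hKb : ⌊dplus⌋₊ ≤ b)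
    (I K : Finset (TorusSite d M) → (TorusSite d M → Fin n → ℝ) → ℝ) (X : Finset (TorusSite d M)) (x : TorusSite d M) :
    DependsOn (sclosure b (block b x)) (mapOneJ b pN dφ dplus I K X (block b x)) :=
  dependsOn_mapOneJ b pN dφ dplus I K hφ hK X (block b x) fun _ hy => reach_subset_sclosure_block hb hbM hKb hy

/-- Admissibility of the step parameters for the regularity of the step data. [cite: Slade2017, §6.3 (L large)] -/
structure StepParams.Adm (P : StepParams d M) : Prop where
  /-- `0 < b`, `b ∣ M` -/
  b_pos : 0 < P.b
  /-- `b ∣ M` -/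
  b_dvd : P.b ∣ M
  /-- `0 < [φ]_j` -/
  dφ_pos : 0 < P.dφ
  /-- no wrapping of monomials -/
  noWrap : 2 * ((⌊P.dplus⌋₊ : ℤ) + 1) < M
  /-- range of `w_j` -/
  rangeW : ∃ r, FinRange P.w r ∧ r ≤ P.b
  /-- `⌊d_+⌋ ≤ b` -/
  reach_le : ⌊P.dplus⌋₊ ≤ P.b
  /-- `A ≥ 4` -/
  A_ge : 4 ≤ P.A

/-- **The regularity hypotheses `StepRegular` hold for Slade's step data** given an admissible
parameter set and `K ∈ 𝒦_j` (field locality, measurability, component factorisation).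
[cite: Slade2017, Definition 6.1.2] [cite: BrydgesSlade2015RGV, §4.1 ((4.1)–(4.3))] -/
theorem stepRegular_sladeStepData (P : StepParams d M) (hP : P.Adm) (Cm : Matrix (TorusSite d M) (TorusSite d M) ℝ)
    (V : ℝ × ℝ × ℝ) (K : Finset (TorusSite d M) → (TorusSite d M → Fin n → ℝ) → ℝ)
    (hKloc : ∀ Y, IsPolymer P.b Y → IsConn Y → DependsOn (sclosure P.b Y) (K Y) ∧ Measurable (K Y))
    (hKfac : ∀ X, IsPolymer P.b X → K X = ∏ Y ∈ components X, K Y) :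
    StepRegular P.b (sladeStepData (n := n) P Cm V K) K := by
  obtain ⟨r, hw, hrb⟩ := hP.rangeW
  refine ⟨fun x => ⟨?_, ?_⟩, fun x => ⟨?_, ?_⟩, fun x => ?_, fun U B h => ?_, fun p hp => ⟨?_, ?_⟩, hKloc, hKfac⟩
  · exact dependsOn_Ifun_block hP.b_pos hP.b_dvd hP.dφ_pos hP.noWrap hw hP.A_ge hrb hP.reach_le _ _ _ x
  · exact measurable_Ifun _ _ _ _ _ _ _ _ _ _
  · exact dependsOn_Ifun_block hP.b_pos hP.b_dvd hP.dφ_pos hP.noWrap hw hP.A_ge hrb hP.reach_le _ _ _ x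
  · exact measurable_Ifun _ _ _ _ _ _ _ _ _ _
  · exact measurable_Ifun _ _ _ _ _ _ _ _ _ _
  · exact mapOneJ_support _ _ _ _ _ _ U B h
  · obtain ⟨x, -, hx⟩ := exists_eq_block_of_mem_blocksOf (mem_djSet.1 hp).2
    rw [hx]
    exact dependsOn_mapOneJ_block hP.b_pos hP.b_dvd hP.dφ_pos hP.noWrap hP.reach_le _ _ p.1 x
  · exact (contDiff_mapOneJ _ _ _ _ _ _ p.1 p.2).continuous.measurable

end Regularity

end Polymer

end LongRangePhi4

end Literature.Barriers.CriticalPhenomena
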